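import Literature.NumberTheory.LFunctions.RiemannXiProofs
import Literature.NumberTheory.LFunctions.ZetaLogDerivDisc
import Literature.NumberTheory.LFunctions.ZetaRealAxis
import Literature.NumberTheory.LFunctions.ZetaLogDerivSeries
import Literature.Analysis.SpecialFunctions.DigammaLogBound
import Mathlib.NumberTheory.LSeries.Dirichlet
import HarnessLib

/-!
# The logarithmic derivative of Riemann's `ξ`: decomposition, symmetries, bounds on the contour

Sibling of `Literature/NumberTheory/LFunctions/RiemannXi.lean` (`Literature.NumberTheory.LFunctions.riemannXi`,
`ξ(s) = ½ s(s−1) π^{-s/2} Γ(s/2) ζ(s)`, entire, `ξ(1−s) = ξ(s)`). This file supplies what the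
contour-integral proof of the Guinand–Weil explicit formula (E. Bombieri, Rend. Lincei (9) 11
(2000), §2: the integral of `(ξ'/ξ)(s) f̃(s)` over the boundary of `[−1/2, 3/2] × [−T, T]`, with the
left edge folded onto the right one by the functional equation) needs about `ξ'/ξ`:

* `riemannXi_eq_mul_of_re_pos` — on `Re s > 0`, `ξ(s) = (s/2) Γ_ℝ(s) ζ₁(s)` with Mathlib's
  `Gammaℝ` and entire `riemannZeta₁` (`= (s−1)ζ(s)`), whence (`logDeriv_riemannXi_eq`)
  `ξ'/ξ = 1/s + Γ_ℝ'/Γ_ℝ + ζ₁'/ζ₁` and, on `Re s > 1` (`logDeriv_riemannXi_eq_of_one_lt_re`, with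
  `Γ_ℝ'/Γ_ℝ = −½ log π + ½ ψ(s/2)` from `Literature.NumberTheory.LFunctions.logDeriv_Gammaℝ`, `ZetaLogDerivSeries.lean`),
  **`ξ'/ξ(s) = 1/s + 1/(s−1) − (log π)/2 + ½ψ(s/2) − Σ Λ(n) n^{-s}`**;
* symmetries: `logDeriv_riemannXi_one_sub` (`ξ'/ξ(1−s) = −ξ'/ξ(s)`), `logDeriv_riemannXi_conj`,
  and `norm_logDeriv_riemannXi_reflect` (`|ξ'/ξ(σ+it)| = |ξ'/ξ(1−σ+it)|`);
* zeros: `riemannXi_ne_zero_of_one_le_re`, `riemannXi_ne_zero_of_re_le_zero`, the zeros of `ξ`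
  lie in the open strip off the real axis, and their multiplicity is the tree's
  `m(ρ) = riemannZetaZeroOrder ρ` (`untop₀_meromorphicOrderAt_riemannXi`);
* **the bound on horizontal segments away from the ordinates of the zeros**
  (`exists_norm_logDeriv_riemannXi_le`): an absolute `C` with
  `|ξ'/ξ(σ + it)| ≤ C log(|t|+4)/η` for `−1/2 ≤ σ ≤ 3/2`, `|t| ≥ 2`, whenever no zero of `ζ` with
  `Re ρ > 0` has ordinate in `(t − η, t + η)` (`0 < η ≤ 1`) — from the partial fraction
  `ζ₁'/ζ₁(s) = Σ_{disc} m(ρ)/(s−ρ) + O(log t)` (`Literature.NumberTheory.LFunctions.exists_norm_logDeriv_riemannZeta₁_sub_sum_le`,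
  Montgomery–Vaughan Lemma 12.1), the Jensen count of the disc, `|ψ(s/2)| ≤ log(|t|+4) + 8`
  (`Literature.Analysis.SpecialFunctions.Complex.norm_digamma_le_log`) and the reflection;
* the bound on the right edge (`exists_norm_logDeriv_riemannXi_vertical_le`):
  `|ξ'/ξ(3/2 + iy)| ≤ C + log(1 + |y|)`, and continuity of `ξ'/ξ` off the zeros.

Everything here is proved; there are no named facts.

## References

* E. Bombieri, *Remarks on Weil's quadratic functional in the theory of prime numbers I*, Rend.
  Mat. Acc. Lincei (9) 11 (2000), 183–233, §2.
* H. L. Montgomery, R. C. Vaughan, *Multiplicative Number Theory I*, CUP 2007, Lemma 12.1,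
  Thm. 10.13.
* E. C. Titchmarsh, *The Theory of the Riemann Zeta-Function*, 2nd ed., OUP 1986, §2.1, §2.12.
-/

noncomputable section

open Complex Filter Topology Set Metric LSeries
open scoped Real ComplexConjugate LSeries.notation ArithmeticFunction.vonMangoldt

namespace Literature.NumberTheory.LFunctions

/-- `log π < 2` (`π < 4`, `log 4 = 2 log 2 < 1.4`). [folklore] -/
theorem log_pi_lt_two : Real.log π < 2 := by
  have h4 : Real.log 4 = 2 * Real.log 2 := by
    rw [show (4 : ℝ) = 2 ^ 2 by norm_num, Real.log_pow]; norm_num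
  have h := Real.log_le_log Real.pi_pos Real.pi_lt_four.le
  have h2 := Real.log_two_lt_d9
  linarith

/-! ### `ξ` as a product on the right half-plane -/

/-- **`ξ(s) = (s/2) Γ_ℝ(s) ζ₁(s)` for `0 < Re s`** (`Γ_ℝ(s) = π^{-s/2}Γ(s/2)`, `ζ₁(s) = (s−1)ζ(s)`,
`ζ₁(1) = 1`; Titchmarsh (2.1.12)). [cite: Titchmarsh1986, §2.1] -/
theorem riemannXi_eq_mul_of_re_pos {s : ℂ} (hs : 0 < s.re) :
    riemannXi s = s / 2 * Gammaℝ s * riemannZeta₁ s := by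
  by_cases h1 : s = 1
  · subst h1
    rw [riemannXi_one, Gammaℝ_one, riemannZeta₁_one]
    norm_num
  have h0 : s ≠ 0 := fun h ↦ by rw [h] at hs; simp at hs
  have hG : Gammaℝ s ≠ 0 := Gammaℝ_ne_zero_of_re_pos hs
  have hΛ : completedRiemannZeta s = Gammaℝ s * riemannZeta s := by
    rw [riemannZeta_def_of_ne_zero h0]
    field_simp
  rw [riemannXi_eq_mul_completedRiemannZeta h0 h1, hΛ, LFunctions.riemannZeta₁_eq_mul h1]
  ring

/-- For `0 < Re s`: `ξ(s) ≠ 0 ↔ ζ₁(s) ≠ 0`. [folklore] -/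
theorem riemannXi_ne_zero_iff_of_re_pos {s : ℂ} (hs : 0 < s.re) :
    riemannXi s ≠ 0 ↔ riemannZeta₁ s ≠ 0 := by
  have h0 : s ≠ 0 := fun h ↦ by rw [h] at hs; simp at hs
  rw [riemannXi_eq_mul_of_re_pos hs]
  simp [h0, Gammaℝ_ne_zero_of_re_pos hs]

/-- **`ξ(s) ≠ 0` for `Re s ≥ 1`** (`ζ₁(1) = 1`, and `ζ(s) ≠ 0` for `Re s ≥ 1`).
[cite: Titchmarsh1986, §2.12] -/
theorem riemannXi_ne_zero_of_one_le_re {s : ℂ} (hs : 1 ≤ s.re) : riemannXi s ≠ 0 := by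
  refine (riemannXi_ne_zero_iff_of_re_pos (by linarith)).2 ?_
  by_cases h1 : s = 1
  · rw [h1, riemannZeta₁_one]; exact one_ne_zero
  rw [LFunctions.riemannZeta₁_eq_mul h1]
  exact mul_ne_zero (sub_ne_zero.2 h1) (riemannZeta_ne_zero_of_one_le_re hs)

/-- `ζ₁(s) ≠ 0` for `Re s ≥ 1`, read off from `ξ(s) ≠ 0` there. [cite: Titchmarsh1986, §2.12] -/
theorem riemannZeta₁_ne_zero_of_riemannXi {s : ℂ} (hs : 1 ≤ s.re) :
    riemannXi s ≠ 0 ∧ riemannZeta₁ s ≠ 0 :=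
  ⟨riemannXi_ne_zero_of_one_le_re hs,
    (riemannXi_ne_zero_iff_of_re_pos (by linarith)).1 (riemannXi_ne_zero_of_one_le_re hs)⟩

/-- **`ξ(s) ≠ 0` for `Re s ≤ 0`** (functional equation). [cite: Titchmarsh1986, §2.12] -/
theorem riemannXi_ne_zero_of_re_le_zero {s : ℂ} (hs : s.re ≤ 0) : riemannXi s ≠ 0 := by
  rw [← riemannXi_one_sub]
  exact riemannXi_ne_zero_of_one_le_re (by simp; linarith)

/-- A zero of `ξ` is a zero of `ζ` in the open critical strip, off the real axis.
[cite: Titchmarsh1986, §2.12] -/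
theorem riemannXi_zero_prop {s : ℂ} (h : riemannXi s = 0) :
    riemannZeta s = 0 ∧ 0 < s.re ∧ s.re < 1 ∧ s.im ≠ 0 := by
  obtain ⟨hζ, h0, h1⟩ := (riemannXi_eq_zero_iff_holds s).1 h
  exact ⟨hζ, h0, h1, LFunctions.im_ne_zero_of_riemannZeta_eq_zero hζ h0 h1⟩

/-! ### The logarithmic derivative -/

/-- For `Re s > 0`, `s/2` is not a pole of `Γ` (the hypothesis of `Literature.NumberTheory.LFunctions.logDeriv_Gammaℝ` and
`Literature.NumberTheory.LFunctions.RealZeros.hasDerivAt_Gammaℝ`). [folklore] -/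
private theorem half_ne_neg_nat_of_re_pos {s : ℂ} (hs : 0 < s.re) (m : ℕ) : s / 2 ≠ -m := by
  intro h
  have hre := congrArg Complex.re h
  simp only [Complex.div_ofNat_re, neg_re, natCast_re] at hre
  linarith [(m.cast_nonneg : (0 : ℝ) ≤ m)]

/-- `Γ_ℝ` is differentiable at every `s` with `Re s > 0` (`Literature.NumberTheory.LFunctions.RealZeros.hasDerivAt_Gammaℝ`,
`LevinsonMontgomery.lean`). [folklore] -/
private theorem differentiableAt_Gammaℝ_of_re_pos {s : ℂ} (hs : 0 < s.re) :
    DifferentiableAt ℂ Gammaℝ s :=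
  (RealZeros.hasDerivAt_Gammaℝ (half_ne_neg_nat_of_re_pos hs)).differentiableAt

/-- **`ξ'/ξ = 1/s + Γ_ℝ'/Γ_ℝ + ζ₁'/ζ₁`** at every `s` with `Re s > 0`, `ζ₁(s) ≠ 0`. [folklore] -/
theorem logDeriv_riemannXi_eq {s : ℂ} (hs : 0 < s.re) (hζ : riemannZeta₁ s ≠ 0) :
    logDeriv riemannXi s = 1 / s + logDeriv Gammaℝ s + logDeriv riemannZeta₁ s := by
  have hev : riemannXi =ᶠ[𝓝 s] fun z ↦ z / 2 * Gammaℝ z * riemannZeta₁ z := by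
    filter_upwards [(isOpen_lt continuous_const Complex.continuous_re).mem_nhds hs] with z hz
    exact riemannXi_eq_mul_of_re_pos hz
  have h1 : logDeriv riemannXi s = logDeriv (fun z ↦ z / 2 * Gammaℝ z * riemannZeta₁ z) s := by
    rw [logDeriv_apply, logDeriv_apply, hev.deriv_eq, hev.eq_of_nhds]
  have h0 : s ≠ 0 := fun h ↦ by rw [h] at hs; simp at hs
  have hs2 : s / 2 ≠ 0 := div_ne_zero h0 two_ne_zero
  have hG : Gammaℝ s ≠ 0 := Gammaℝ_ne_zero_of_re_pos hs
  have hdG := differentiableAt_Gammaℝ_of_re_pos hs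
  have hd2 : DifferentiableAt ℂ (fun z : ℂ ↦ z / 2) s := differentiableAt_id.div_const 2
  rw [h1, logDeriv_mul (f := fun z ↦ z / 2 * Gammaℝ z) (g := riemannZeta₁) s
      (mul_ne_zero hs2 hG) hζ (hd2.mul hdG) (differentiable_riemannZeta₁ s),
    logDeriv_mul (f := fun z : ℂ ↦ z / 2) (g := Gammaℝ) s hs2 hG hd2 hdG]
  have : logDeriv (fun z : ℂ ↦ z / 2) s = 1 / s := by
    rw [logDeriv_apply, deriv_div_const, deriv_id'']
    field_simp
  rw [this]

/-- On `Re s > 1`: `ζ₁'/ζ₁(s) = 1/(s−1) − Σ Λ(n) n^{-s}`. [folklore] -/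
theorem logDeriv_riemannZeta₁_eq_of_one_lt_re {s : ℂ} (hs : 1 < s.re) :
    logDeriv riemannZeta₁ s = 1 / (s - 1) - L ↗Λ s := by
  have h1 : s ≠ 1 := fun h ↦ by rw [h] at hs; simp at hs
  have hζ : riemannZeta s ≠ 0 := riemannZeta_ne_zero_of_one_le_re hs.le
  have h := LFunctions.logDeriv_riemannZeta_eq h1 hζ
  rw [ArithmeticFunction.LSeries_vonMangoldt_eq_deriv_riemannZeta_div hs, neg_div, sub_neg_eq_add,
    ← logDeriv_apply, h]
  simp

/-- **`ξ'/ξ` on `Re s > 1`**: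
`ξ'/ξ(s) = 1/s + 1/(s−1) − (log π)/2 + ½ψ(s/2) − Σₙ Λ(n) n^{-s}` (Bombieri §2: the logarithmic
derivative of `π^{-s/2}Γ(s/2)ζ(s)` on the line of integration). [cite: Bombieri2000Weil, §2] -/
theorem logDeriv_riemannXi_eq_of_one_lt_re {s : ℂ} (hs : 1 < s.re) :
    logDeriv riemannXi s = 1 / s + 1 / (s - 1) +
      (-(Real.log π : ℂ) / 2 + 1 / 2 * digamma (s / 2)) - L ↗Λ s := by
  rw [logDeriv_riemannXi_eq (by linarith) (riemannZeta₁_ne_zero_of_riemannXi hs.le).2,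
    LFunctions.logDeriv_Gammaℝ (half_ne_neg_nat_of_re_pos (by linarith)),
    logDeriv_riemannZeta₁_eq_of_one_lt_re hs, ← Complex.ofReal_log Real.pi_pos.le]
  ring

/-! ### Symmetries of `ξ'/ξ` -/

/-- `ξ'(1 − s) = −ξ'(s)` (differentiate `ξ(1 − s) = ξ(s)`). [folklore] -/
theorem deriv_riemannXi_one_sub (s : ℂ) : deriv riemannXi (1 - s) = -deriv riemannXi s := by
  have h : (fun z ↦ riemannXi (1 - z)) = riemannXi := funext riemannXi_one_sub
  have hd : HasDerivAt (fun z ↦ riemannXi (1 - z)) (deriv riemannXi (1 - s) * (-1)) s := by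
    have h1 : HasDerivAt (fun z : ℂ ↦ 1 - z) (-1) s := (hasDerivAt_id' s).const_sub 1
    exact (differentiable_riemannXi (1 - s)).hasDerivAt.comp s h1
  rw [h] at hd
  rw [hd.deriv]
  ring

/-- **`ξ'/ξ(1 − s) = −ξ'/ξ(s)`** (Bombieri §2: used to fold the left edge onto the right one).
[cite: Bombieri2000Weil, §2] -/
theorem logDeriv_riemannXi_one_sub (s : ℂ) :
    logDeriv riemannXi (1 - s) = -logDeriv riemannXi s := by
  rw [logDeriv_apply, logDeriv_apply, deriv_riemannXi_one_sub, riemannXi_one_sub, neg_div]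

/-- `ξ'(s̄) = conj ξ'(s)` (from `ξ(s̄) = conj ξ(s)`). [folklore] -/
theorem deriv_riemannXi_conj (s : ℂ) : deriv riemannXi (conj s) = conj (deriv riemannXi s) := by
  have hfun : (conj ∘ riemannXi ∘ conj : ℂ → ℂ) = riemannXi := by
    funext z; simp [Function.comp_apply, riemannXi_conj_holds z]
  have h : deriv (conj ∘ riemannXi ∘ conj : ℂ → ℂ) = conj ∘ deriv riemannXi ∘ conj :=
    deriv_conj_conj
  rw [hfun] at h
  have h' := congrFun h (conj s)
  simpa using h'

/-- `ξ'/ξ(s̄) = conj ξ'/ξ(s)`. [folklore] -/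
theorem logDeriv_riemannXi_conj (s : ℂ) :
    logDeriv riemannXi (conj s) = conj (logDeriv riemannXi s) := by
  rw [logDeriv_apply, logDeriv_apply, deriv_riemannXi_conj, riemannXi_conj_holds s, map_div₀]

/-- **Reflection of `|ξ'/ξ|` in the critical line on horizontal segments**:
`|ξ'/ξ(σ + it)| = |ξ'/ξ((1 − σ) + it)|` (functional equation and conjugation). [folklore] -/
theorem norm_logDeriv_riemannXi_reflect (σ t : ℝ) :
    ‖logDeriv riemannXi (σ + t * I)‖ = ‖logDeriv riemannXi ((1 - σ : ℝ) + t * I)‖ := by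
  have : (σ : ℂ) + t * I = 1 - conj (((1 - σ : ℝ) : ℂ) + t * I) := by
    apply Complex.ext <;> simp
  rw [this, logDeriv_riemannXi_one_sub, norm_neg, logDeriv_riemannXi_conj, Complex.norm_conj]

/-! ### Multiplicities -/

/-- `z ↦ (z/2) Γ_ℝ(z)` is analytic and non-zero at every point of `Re z > 0`. [folklore] -/
theorem analyticAt_half_mul_Gammaℝ {ρ : ℂ} (h0 : 0 < ρ.re) :
    AnalyticAt ℂ (fun z : ℂ ↦ z / 2 * Gammaℝ z) ρ :=
  ((differentiableOn_id.div_const (2 : ℂ)).mul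
      fun _ hz ↦ (differentiableAt_Gammaℝ_of_re_pos hz).differentiableWithinAt).analyticAt
    ((isOpen_lt continuous_const Complex.continuous_re).mem_nhds h0)

/-- For `Re ρ > 0`, `ρ ≠ 1`: `ξ` and `ζ` have the same meromorphic order at `ρ`. [folklore] -/
theorem meromorphicOrderAt_riemannXi_eq {ρ : ℂ} (h0 : 0 < ρ.re) (h1 : ρ ≠ 1) :
    meromorphicOrderAt riemannXi ρ = meromorphicOrderAt riemannZeta ρ := by
  have hev : riemannXi =ᶠ[𝓝 ρ] (fun z : ℂ ↦ z / 2 * Gammaℝ z) * riemannZeta₁ := by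
    filter_upwards [(isOpen_lt continuous_const Complex.continuous_re).mem_nhds h0] with z hz
    rw [Pi.mul_apply, riemannXi_eq_mul_of_re_pos hz]
  rw [meromorphicOrderAt_congr (hev.filter_mono nhdsWithin_le_nhds),
    ← LFunctions.meromorphicOrderAt_riemannZeta₁_eq h1]
  have hρ0 : ρ ≠ 0 := fun h ↦ by rw [h] at h0; simp at h0
  exact meromorphicOrderAt_mul_of_ne_zero (analyticAt_half_mul_Gammaℝ h0)
    (mul_ne_zero (div_ne_zero hρ0 two_ne_zero) (Gammaℝ_ne_zero_of_re_pos h0))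

/-- **The multiplicity of a zero of `ξ` is `m(ρ) = riemannZetaZeroOrder ρ`** (`Re ρ > 0`,
`ρ ≠ 1`; in particular at every non-trivial zero). [cite: Titchmarsh1986, §2.12] -/
theorem untop₀_meromorphicOrderAt_riemannXi {ρ : ℂ} (h0 : 0 < ρ.re) (h1 : ρ ≠ 1) :
    (meromorphicOrderAt riemannXi ρ).untop₀ = riemannZetaZeroOrder ρ := by
  rw [meromorphicOrderAt_riemannXi_eq h0 h1, riemannZetaZeroOrder]

/-! ### Continuity of `ξ'/ξ` off the zeros -/

/-- `ξ'` is continuous (indeed entire). [folklore] -/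
theorem continuous_deriv_riemannXi : Continuous (deriv riemannXi) :=
  (differentiable_riemannXi.contDiff (n := 1)).continuous_deriv le_rfl

/-- `ξ'/ξ` is continuous on the complement of the zeros of `ξ`. [folklore] -/
theorem continuousOn_logDeriv_riemannXi : ContinuousOn (logDeriv riemannXi) {s | riemannXi s ≠ 0} := by
  have : logDeriv riemannXi = fun s ↦ deriv riemannXi s / riemannXi s := by
    funext s; rw [logDeriv_apply]
  rw [this]
  exact continuous_deriv_riemannXi.continuousOn.div differentiable_riemannXi.continuous.continuousOn
    fun s hs ↦ hs

/-- `y ↦ ξ'/ξ(c + iy)` is continuous for `c ≥ 1`. [folklore] -/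
theorem continuous_logDeriv_riemannXi_vertical {c : ℝ} (hc : 1 ≤ c) :
    Continuous fun y : ℝ ↦ logDeriv riemannXi (c + y * I) :=
  continuousOn_logDeriv_riemannXi.comp_continuous (by fun_prop)
    fun y ↦ riemannXi_ne_zero_of_one_le_re (by simpa using hc)

/-! ### Bounds on `ζ₁'/ζ₁` and `ξ'/ξ` on horizontal segments away from the zeros -/

/-- **`ζ₁'/ζ₁` on `1/4 ≤ σ ≤ 2` at a height `t` avoided by the ordinates.** There is an absolute
`C > 0` such that for all real `t` and `0 < η ≤ 1` for which no zero `ρ` of `ζ` with `Re ρ > 0` has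
`|Im ρ − t| < η`, and all `σ ∈ [1/4, 2]`,
`|ζ₁'/ζ₁(σ + it)| ≤ C log(|t| + 4)/η` (partial fraction over the disc `|s − (2+it)| ≤ 37/20`,
each term `m(ρ)/|s − ρ| ≤ m(ρ)/η`, and the Jensen count of the disc).
[cite: MontgomeryVaughan2007, Lemma 12.1] -/
theorem exists_norm_logDeriv_riemannZeta₁_le :
    ∃ C : ℝ, 0 < C ∧ ∀ (t η : ℝ), 0 < η → η ≤ 1 →
      (∀ ρ : ℂ, riemannZeta ρ = 0 → 0 < ρ.re → η ≤ |ρ.im - t|) →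
      ∀ σ : ℝ, σ ∈ Icc (1 / 4 : ℝ) 2 →
        ‖logDeriv riemannZeta₁ (σ + t * I)‖ ≤ C * Real.log (|t| + 4) / η := by
  obtain ⟨C₁, hC₁, h₁⟩ := LFunctions.exists_norm_logDeriv_riemannZeta₁_sub_sum_le
  obtain ⟨C₂, hC₂, h₂⟩ := LFunctions.exists_sum_zetaDiscZeros_le
  refine ⟨C₁ + C₂, by positivity, fun t η hη hη1 hZ σ hσ ↦ ?_⟩
  set s : ℂ := σ + t * I with hs_def
  have hsB : s ∈ closedBall (2 + (t : ℂ) * I) (7 / 4) := LFunctions.mem_closedBall_of_re_mem_Icc hσ t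
  have hL0 : 0 ≤ Real.log (|t| + 4) := Real.log_nonneg (by linarith [abs_nonneg t])
  -- `ζ₁(s) ≠ 0`: a zero at `s` would have ordinate `t`
  have hζ : riemannZeta₁ s ≠ 0 := by
    intro h0
    have hz := LFunctions.riemannZeta_eq_zero_of_riemannZeta₁ h0
    have := hZ s hz (by simp [hs_def]; linarith [hσ.1])
    simp [hs_def] at this
    linarith
  have hmain := h₁ t s hsB hζ
  -- the sum over the disc
  have hsum : ‖∑ ρ ∈ LFunctions.zetaDiscZeros t, (LFunctions.zetaDiscDivisor t ρ : ℂ) / (s - ρ)‖ ≤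
      C₂ * Real.log (|t| + 4) / η := by
    refine (norm_sum_le _ _).trans ?_
    have hterm : ∀ ρ ∈ LFunctions.zetaDiscZeros t,
        ‖(LFunctions.zetaDiscDivisor t ρ : ℂ) / (s - ρ)‖ ≤ (LFunctions.zetaDiscDivisor t ρ : ℝ) / η := by
      intro ρ hρ
      obtain ⟨hz, -, -, hre, -, -⟩ := LFunctions.zetaDiscZeros_prop hρ
      have hdist : η ≤ ‖s - ρ‖ := by
        have h := hZ ρ hz (by linarith)
        have him : |(s - ρ).im| = |ρ.im - t| := by
          rw [abs_sub_comm]; simp [hs_def]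
        calc η ≤ |ρ.im - t| := h
          _ = |(s - ρ).im| := him.symm
          _ ≤ ‖s - ρ‖ := Complex.abs_im_le_norm _
      have hm0 : (0 : ℝ) ≤ LFunctions.zetaDiscDivisor t ρ := by exact_mod_cast LFunctions.zetaDiscDivisor_nonneg t ρ
      rw [norm_div, Complex.norm_intCast, abs_of_nonneg hm0]
      exact div_le_div_of_nonneg_left hm0 hη hdist
    calc ∑ ρ ∈ LFunctions.zetaDiscZeros t, ‖(LFunctions.zetaDiscDivisor t ρ : ℂ) / (s - ρ)‖
        ≤ ∑ ρ ∈ LFunctions.zetaDiscZeros t, (LFunctions.zetaDiscDivisor t ρ : ℝ) / η := Finset.sum_le_sum hterm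
      _ = (∑ ρ ∈ LFunctions.zetaDiscZeros t, (LFunctions.zetaDiscDivisor t ρ : ℝ)) / η := by
          rw [Finset.sum_div]
      _ ≤ C₂ * Real.log (|t| + 4) / η := div_le_div_of_nonneg_right (h₂ t) hη.le
  have hC₁' : C₁ * Real.log (|t| + 4) ≤ C₁ * Real.log (|t| + 4) / η := by
    rw [le_div_iff₀ hη]
    have : C₁ * Real.log (|t| + 4) * η ≤ C₁ * Real.log (|t| + 4) * 1 :=
      mul_le_mul_of_nonneg_left hη1 (mul_nonneg hC₁.le hL0)
    linarith
  calc ‖logDeriv riemannZeta₁ s‖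
      = ‖(logDeriv riemannZeta₁ s - ∑ ρ ∈ LFunctions.zetaDiscZeros t, (LFunctions.zetaDiscDivisor t ρ : ℂ) / (s - ρ)) +
          ∑ ρ ∈ LFunctions.zetaDiscZeros t, (LFunctions.zetaDiscDivisor t ρ : ℂ) / (s - ρ)‖ := by rw [sub_add_cancel]
    _ ≤ C₁ * Real.log (|t| + 4) + C₂ * Real.log (|t| + 4) / η := (norm_add_le _ _).trans (add_le_add hmain hsum)
    _ ≤ C₁ * Real.log (|t| + 4) / η + C₂ * Real.log (|t| + 4) / η := by linarith
    _ = (C₁ + C₂) * Real.log (|t| + 4) / η := by ring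

/-- `|Γ_ℝ'/Γ_ℝ(σ + it)| ≤ log(|t| + 4)/2 + 5` for `0 < σ ≤ 2`, `|t| ≥ 1`. [folklore] -/
theorem norm_logDeriv_Gammaℝ_le {σ t : ℝ} (hσ0 : 0 < σ) (hσ2 : σ ≤ 2) (ht : 1 ≤ |t|) :
    ‖logDeriv Gammaℝ (σ + t * I)‖ ≤ Real.log (|t| + 4) / 2 + 5 := by
  have hre : 0 < ((σ : ℂ) + t * I).re := by simpa using hσ0
  rw [LFunctions.logDeriv_Gammaℝ (half_ne_neg_nat_of_re_pos hre), ← Complex.ofReal_log Real.pi_pos.le]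
  set w : ℂ := ((σ : ℂ) + t * I) / 2 with hw
  rw [show digamma w / 2 = 1 / 2 * digamma w from by ring]
  have hwre : 0 < w.re := by simp [hw]; positivity
  have hwim : 1 / 2 ≤ |w.im| := by
    have : w.im = t / 2 := by simp [hw]
    rw [this, abs_div, abs_two]; linarith
  have hψ := Literature.Analysis.SpecialFunctions.Complex.norm_digamma_le_log hwre hwim
  have hwn : ‖w‖ ≤ |t| + 3 := by
    have h1 : ‖(σ : ℂ) + t * I‖ ≤ |σ| + |t| := by
      refine (norm_add_le _ _).trans ?_
      simp
    have h2 : ‖w‖ = ‖(σ : ℂ) + t * I‖ / 2 := by simp [hw]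
    rw [h2, abs_of_pos hσ0] at *
    linarith [norm_nonneg ((σ : ℂ) + t * I)]
  have hlog : Real.log (1 + ‖w‖) ≤ Real.log (|t| + 4) :=
    Real.log_le_log (by positivity) (by linarith)
  have hπ : ‖(-(Real.log π : ℂ)) / 2‖ ≤ 1 := by
    rw [norm_div, norm_neg, Complex.norm_real, Real.norm_eq_abs, Complex.norm_two,
      abs_of_pos (Real.log_pos (by linarith [Real.pi_gt_three]))]
    linarith [log_pi_lt_two]
  calc ‖-(Real.log π : ℂ) / 2 + 1 / 2 * digamma w‖
      ≤ ‖-(Real.log π : ℂ) / 2‖ + ‖(1 / 2 : ℂ) * digamma w‖ := norm_add_le _ _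
    _ ≤ 1 + 1 / 2 * (Real.log (1 + ‖w‖) + 8) := by
        rw [norm_mul]
        gcongr
        simp
    _ ≤ Real.log (|t| + 4) / 2 + 5 := by linarith

/-- **`ξ'/ξ` on the horizontal segments `−1/2 ≤ σ ≤ 3/2`, `|t| ≥ 2`, away from the ordinates of
the zeros.** There is an absolute `C > 0` such that for all `t` with `|t| ≥ 2` and `0 < η ≤ 1` for
which no zero `ρ` of `ζ` with `Re ρ > 0` has `|Im ρ − t| < η`, and all `σ ∈ [−1/2, 3/2]`,
`|ξ'/ξ(σ + it)| ≤ C log(|t| + 4)/η`. (`ξ'/ξ = 1/s + Γ_ℝ'/Γ_ℝ + ζ₁'/ζ₁` on `1/2 ≤ σ ≤ 3/2`, the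
digamma bound, `exists_norm_logDeriv_riemannZeta₁_le`, and `|ξ'/ξ(σ+it)| = |ξ'/ξ(1−σ+it)|` for
`σ < 1/2`; Bombieri §2: the horizontal integrals tend to `0` along well-chosen `T → ∞`.)
[cite: Bombieri2000Weil, §2] -/
theorem exists_norm_logDeriv_riemannXi_le :
    ∃ C : ℝ, 0 < C ∧ ∀ (t η : ℝ), 2 ≤ |t| → 0 < η → η ≤ 1 →
      (∀ ρ : ℂ, riemannZeta ρ = 0 → 0 < ρ.re → η ≤ |ρ.im - t|) →
      ∀ σ : ℝ, σ ∈ Icc (-(1 / 2) : ℝ) (3 / 2) →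
        ‖logDeriv riemannXi (σ + t * I)‖ ≤ C * Real.log (|t| + 4) / η := by
  obtain ⟨C₀, hC₀, h₀⟩ := exists_norm_logDeriv_riemannZeta₁_le
  refine ⟨C₀ + 7, by positivity, fun t η ht hη hη1 hZ ↦ ?_⟩
  -- the right half `1/2 ≤ σ ≤ 3/2`
  have key : ∀ σ : ℝ, σ ∈ Icc (1 / 2 : ℝ) (3 / 2) →
      ‖logDeriv riemannXi (σ + t * I)‖ ≤ (C₀ + 7) * Real.log (|t| + 4) / η := by
    intro σ hσ
    set s : ℂ := σ + t * I with hs_def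
    have hre : 0 < s.re := by simp [hs_def]; linarith [hσ.1]
    have hζ : riemannZeta₁ s ≠ 0 := by
      intro h0
      have hz := LFunctions.riemannZeta_eq_zero_of_riemannZeta₁ h0
      have := hZ s hz hre
      simp [hs_def] at this
      linarith
    have hL : 1 ≤ Real.log (|t| + 4) := by
      have h4 : Real.log 4 = 2 * Real.log 2 := by
        rw [show (4 : ℝ) = 2 ^ 2 by norm_num, Real.log_pow]; norm_num
      have h2 := Real.log_two_gt_d9
      calc (1 : ℝ) ≤ Real.log 4 := by rw [h4]; linarith
        _ ≤ Real.log (|t| + 4) := Real.log_le_log (by norm_num) (by linarith [abs_nonneg t])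
    set Lg := Real.log (|t| + 4) with hLg_def
    rw [logDeriv_riemannXi_eq hre hζ]
    have h1 : ‖1 / s‖ ≤ 1 / 2 := by
      rw [norm_div, norm_one]
      have : (2 : ℝ) ≤ ‖s‖ := ht.trans (by simpa [hs_def] using Complex.abs_im_le_norm s)
      exact one_div_le_one_div_of_le two_pos this
    have h2 : ‖logDeriv Gammaℝ s‖ ≤ Lg / 2 + 5 :=
      norm_logDeriv_Gammaℝ_le (by linarith [hσ.1]) (by linarith [hσ.2]) (by linarith)
    have h3 : ‖logDeriv riemannZeta₁ s‖ ≤ C₀ * Lg / η :=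
      h₀ t η hη hη1 hZ σ ⟨by linarith [hσ.1], by linarith [hσ.2]⟩
    have hLη : Lg ≤ Lg / η := by
      rw [le_div_iff₀ hη]; nlinarith
    have hη' : 1 ≤ 1 / η := by rw [le_div_iff₀ hη]; linarith
    calc ‖1 / s + logDeriv Gammaℝ s + logDeriv riemannZeta₁ s‖
        ≤ ‖1 / s‖ + ‖logDeriv Gammaℝ s‖ + ‖logDeriv riemannZeta₁ s‖ := norm_add₃_le
      _ ≤ 1 / 2 + (Lg / 2 + 5) + C₀ * Lg / η := by gcongr
      _ ≤ 7 * (Lg / η) + C₀ * Lg / η := by nlinarith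
      _ = (C₀ + 7) * Lg / η := by ring
  intro σ hσ
  rcases le_or_gt (1 / 2 : ℝ) σ with h | h
  · exact key σ ⟨h, hσ.2⟩
  · rw [norm_logDeriv_riemannXi_reflect]
    exact key (1 - σ) ⟨by linarith, by linarith [hσ.1]⟩

/-! ### `ξ'/ξ` on the right edge `σ = 3/2` -/

/-- `|Σ Λ(n) n^{-s}| ≤ Σ Λ(n) n^{-3/2}` on `Re s = 3/2`. [folklore] -/
theorem norm_LSeries_vonMangoldt_le (y : ℝ) :
    ‖L ↗Λ ((3 / 2 : ℝ) + y * I)‖ ≤ ∑' n : ℕ, ‖term ↗Λ (3 / 2 : ℂ) n‖ := by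
  set s : ℂ := (3 / 2 : ℝ) + y * I with hs
  have hre : s.re = (3 / 2 : ℂ).re := by simp [hs]
  have hsum : Summable fun n ↦ ‖term ↗Λ s n‖ := by
    have h := ArithmeticFunction.LSeriesSummable_vonMangoldt (s := s) (by simp [hs]; norm_num)
    exact summable_norm_iff.mpr h
  have heq : ∀ n, ‖term ↗Λ s n‖ = ‖term ↗Λ (3 / 2 : ℂ) n‖ := by
    intro n
    rw [norm_term_eq, norm_term_eq, hre]
  calc ‖L ↗Λ s‖ = ‖∑' n, term ↗Λ s n‖ := rfl
    _ ≤ ∑' n, ‖term ↗Λ s n‖ := norm_tsum_le_tsum_norm hsum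
    _ = ∑' n, ‖term ↗Λ (3 / 2 : ℂ) n‖ := tsum_congr heq

/-- **`ξ'/ξ` on the line `σ = 3/2`**: there is `C` with `|ξ'/ξ(3/2 + iy)| ≤ C + log(1 + |y|)`
for all real `y` (Bombieri §2: `ξ'/ξ` is of logarithmic order on the line of integration).
[cite: Bombieri2000Weil, §2] -/
theorem exists_norm_logDeriv_riemannXi_vertical_le :
    ∃ C : ℝ, ∀ y : ℝ, ‖logDeriv riemannXi ((3 / 2 : ℝ) + y * I)‖ ≤ C + Real.log (1 + |y|) := by
  obtain ⟨Cψ, hψ⟩ := Literature.Analysis.SpecialFunctions.Complex.exists_norm_digamma_vertical_le (a := 3 / 4) (by norm_num)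
  set M : ℝ := ∑' n : ℕ, ‖term ↗Λ (3 / 2 : ℂ) n‖ with hM
  refine ⟨2 / 3 + 2 + 1 + Cψ / 2 + M, fun y ↦ ?_⟩
  set s : ℂ := (3 / 2 : ℝ) + y * I with hs
  have hre : 1 < s.re := by simp [hs]; norm_num
  rw [logDeriv_riemannXi_eq_of_one_lt_re hre]
  have hsre : s.re = 3 / 2 := by simp [hs]
  have hs1re : (s - 1).re = 1 / 2 := by simp [hs]; norm_num
  have h1 : ‖1 / s‖ ≤ 2 / 3 := by
    rw [norm_div, norm_one]
    have : (3 / 2 : ℝ) ≤ ‖s‖ := by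
      have h := Complex.abs_re_le_norm s
      rwa [hsre, abs_of_pos (by norm_num : (0 : ℝ) < 3 / 2)] at h
    rw [div_le_div_iff₀ (by linarith) (by norm_num)]
    linarith
  have h2 : ‖1 / (s - 1)‖ ≤ 2 := by
    rw [norm_div, norm_one]
    have : (1 / 2 : ℝ) ≤ ‖s - 1‖ := by
      have h := Complex.abs_re_le_norm (s - 1)
      rwa [hs1re, abs_of_pos (by norm_num : (0 : ℝ) < 1 / 2)] at h
    rw [div_le_iff₀ (by linarith)]
    linarith
  have h3 : ‖-(Real.log π : ℂ) / 2 + 1 / 2 * digamma (s / 2)‖ ≤ 1 + (Cψ + Real.log (1 + |y|)) / 2 := by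
    have hπ : ‖(-(Real.log π : ℂ)) / 2‖ ≤ 1 := by
      rw [norm_div, norm_neg, Complex.norm_real, Real.norm_eq_abs, Complex.norm_two,
        abs_of_pos (Real.log_pos (by linarith [Real.pi_gt_three]))]
      linarith [log_pi_lt_two]
    have hw : s / 2 = ((3 / 4 : ℝ) : ℂ) + (y / 2 : ℝ) * I := by
      simp [hs]; ring
    have hψ' := hψ (y / 2)
    rw [← hw] at hψ'
    have hlog : Real.log (1 + |y / 2|) ≤ Real.log (1 + |y|) := by
      refine Real.log_le_log (by positivity) ?_
      rw [abs_div, abs_two]; linarith [abs_nonneg y]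
    calc ‖-(Real.log π : ℂ) / 2 + 1 / 2 * digamma (s / 2)‖
        ≤ ‖-(Real.log π : ℂ) / 2‖ + ‖(1 / 2 : ℂ) * digamma (s / 2)‖ := norm_add_le _ _
      _ ≤ 1 + 1 / 2 * (Cψ + Real.log (1 + |y / 2|)) := by
          rw [norm_mul]; gcongr; simp
      _ ≤ 1 + (Cψ + Real.log (1 + |y|)) / 2 := by linarith
  have h4 : ‖L ↗Λ s‖ ≤ M := norm_LSeries_vonMangoldt_le y
  have hlog0 : 0 ≤ Real.log (1 + |y|) := Real.log_nonneg (by linarith [abs_nonneg y])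
  calc ‖1 / s + 1 / (s - 1) + (-(Real.log π : ℂ) / 2 + 1 / 2 * digamma (s / 2)) - L ↗Λ s‖
      ≤ ‖1 / s + 1 / (s - 1) + (-(Real.log π : ℂ) / 2 + 1 / 2 * digamma (s / 2))‖ + ‖L ↗Λ s‖ :=
        norm_sub_le _ _
    _ ≤ ‖1 / s‖ + ‖1 / (s - 1)‖ + ‖-(Real.log π : ℂ) / 2 + 1 / 2 * digamma (s / 2)‖ + ‖L ↗Λ s‖ := by
        gcongr; exact norm_add₃_le
    _ ≤ 2 / 3 + 2 + (1 + (Cψ + Real.log (1 + |y|)) / 2) + M := by gcongr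
    _ ≤ 2 / 3 + 2 + 1 + Cψ / 2 + M + Real.log (1 + |y|) := by linarith

end Literature.NumberTheory.LFunctions

end
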